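import Literature.AlgebraicGeometry.Resolution.SncStrata
import Literature.AlgebraicGeometry.Resolution.StalkIdealGenerization
import HarnessLib

/-!
# Crux `PatchingRelPerfect` (stmt-ResolutionOfSingularities-16161), chain W5.2 — F7(β) (β-AX) X3 C-I (M2b) cure §2b: ZERO SETS TO PRIMES —
# a support inclusion near a point bounds the primes of the local ring containing the stalk

[OURS · L1 W5.2 · cure plan of record (res-L1-w52-lead-1 g6).]  Replaces the role of NO printed item; NOT a statement of the manuscript under
review (AI-written; AI review weaker than expert review; counted 0).  Def-free, fact-free.  The dictionary step feeding §2a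
(`exists_isUnit_mul_prod_pow_of_forall_prime`): if `Supp F ∩ U₀ ⊆ ⋃ᵢ Supp Zᵢ` on an open `U₀ ∋ t`, then every prime `𝔭` of `𝒪_{X,t}` with
`F_t ≤ 𝔭` contains some `(Zᵢ)_t` — the primes of `𝒪_{X,t}` are the generisations of `t` (`Spec 𝒪_{X,t} → X`, Stacks 01J7), and `I_t ≤ 𝔭_η ↔
η ∈ Supp I`.

## References
* The Stacks Project, Tag 01J7. [StacksProject]
-/

-- `Summit.<Summit>.<Sub>.Theorems` with `Sub = Summit` (single-conjunct summit, D-0017)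
set_option linter.dupNamespace false

noncomputable section

namespace Summit.ResolutionOfSingularities.ResolutionOfSingularities.Theorems.X3LemmaM

open CategoryTheory AlgebraicGeometry TopologicalSpace IsLocalRing
open Literature.AlgebraicGeometry.Resolution
open Scheme.IdealSheafData

universe u

/-- [OURS · L1 W5.2 · cure §2b] **ZERO SETS TO PRIMES.**  If the support of `F` near `t` lies in the union of the supports of the `Zᵢ`, then
every prime of `𝒪_{X,t}` containing `F_t` contains some `(Zᵢ)_t`. [cite: StacksProject, Tag 01J7] -/
theorem exists_stalkIdeal_le_of_support_subset {X : Scheme.{u}} {t : X} {ι : Type*} (F : X.IdealSheafData) (Z : ι → X.IdealSheafData)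
    (U₀ : X.Opens) (ht : t ∈ U₀) (hsub : (F.support : Set X) ∩ (U₀ : Set X) ⊆ ⋃ i, (Z i).support)
    (𝔭 : Ideal (X.presheaf.stalk t)) [𝔭.IsPrime] (hF : stalkIdeal F t ≤ 𝔭) :
    ∃ i, stalkIdeal (Z i) t ≤ 𝔭 := by
  let q : Spec (X.presheaf.stalk t) := ⟨𝔭, inferInstance⟩
  have hη : X.fromSpecStalk t q ⤳ t := fromSpecStalk_specializes q
  have hq : primeOfSpecializes hη = 𝔭 := primeOfSpecializes_fromSpecStalk q
  have hηF : X.fromSpecStalk t q ∈ F.support := by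
    rw [mem_support_iff_stalkIdeal_le_primeOfSpecializes hη, hq]; exact hF
  have hηU : X.fromSpecStalk t q ∈ (U₀ : Set X) := hη.mem_open U₀.isOpen ht
  obtain ⟨i, hi⟩ := Set.mem_iUnion.mp (hsub ⟨hηF, hηU⟩)
  exact ⟨i, by rw [← hq]; exact (mem_support_iff_stalkIdeal_le_primeOfSpecializes hη (Z i)).mp hi⟩

end Summit.ResolutionOfSingularities.ResolutionOfSingularities.Theorems.X3LemmaM

end
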